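import Summits.CriticalPhenomena.PercolationContinuityZ3.Theorems.PercNearOneGluingNoHeavyQuantSingleGatePieceBudget
import HarnessLib

/-!
# QUANT lane R8, T-DEC: `SingleGateConvClosed` AT THE FAR-DOMINANT LAYERS `4j < q(2T₂ + T₁)` — NO HEAVINESS NEEDED
# (the q < 1 companion of `…QuantConvFarDominant`; light credit pairs of BOTH gated factors allowed)

builds on p205010 (kernel theorem, internal audit signed; external expert review pending)

Support file (`--supports stmt-CriticalPhenomena-4575`), QUANT lane seat prim-quant-arm-2 (gen 34), rung R8 of
`run/shared/lean/prim/quant/LADDER.md`.  Theorems only (no definitions), standard axioms, no sorries.  Part 2 of 2 (part 1 `…QuantSingleGatePieceBudget`: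
the per-component budget `gated_piece_budget` and `sum_datum`); uses `gateConv_tail_eq_pieces`, `gateConv_tail_ge_theta`, `deepLows_le_giants_pred`.

WHAT.  `0 < y < 1`, `y ≤ q ≤ 1`; `μ₁`, `μ₂` probability laws on `{0..M₁}`, `{0..M₂}` (means `T₁`, `T₂`) whose gated laws `νᵢ = gate_q μᵢ` are
top-affordable (`y·Mᵢ ≤ q·Tᵢ`) and DEC at every layer below their tops — the hypotheses of `SingleGateConvClosed`, ANY data; a layer `j` with
`4j < q(2T₂ + T₁)`.  THEN **`y ≤ Σ_{h > j} gate_q(μ₁ ∗ μ₂) h`** (`gateConv_tail_ge_farDominant`); DEC form and the two-sided corollary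
**`gateConv_decAt_farDominant`** (`4j < q(2T₂+T₁) ∨ 4j < q(2T₁+T₂)`: three quarters of the dominant range, no heaviness on either factor).
PROOF.  `P{>j} = Σ_r λ_r W_r − (1−q)θ/q` over `ν₂`'s DEC datum at layer `j` (bare tails `Ψ`, `θ = ν₁{>j} ≤ P{>j}`: `…QuantSingleGateDominant`).
Split each component's weight as `up + v + a` (`up` = mass above `j`; `v` = the low of a giant pair when it is DEEP, `lo + j < qT₂`; `a` = the rest)
and give it a debt `d ≤ a` (the deep mass of a LIGHT credit pair; such a pair has `lo ≥ 1`, a light zero-component being impossible under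
top-affordability).  Per piece (`piece_budget` on `ν₁` for the credit pairs, the rows / the two-layer bound of `ν₁` otherwise):
`W_r ≥ y + u_r + v_r·θ/q − (y/q)·d_r` with `u_r = (1−y)up_r − y·v_r + ((1−q)y/q)·a_r`.  Summing: `X + V + A = 1` (`X = ν₂{>j}`),
`V + D ≤ ν₂{deep}`, `D ≤ ν₂{deep, ≥ 1}`; `deepLows_le_giants_pred` for `ν₂` gives `y·ν₂{deep} ≤ (1−y)X`; and if `D > 0` the zero atom
(mass `≥ 1−q`) is deep and all deep atoms are lows (`≤ 1−y` in total), so `D ≤ q − y`.  The total `y + U + (V − (1−q))θ/q − (y/q)D` is affine in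
`θ`: for `V ≥ 1−q` it is `≥ y` because `U ≥ (y/q)D`; for `V < 1−q` and `θ ≤ y` it is `≥ y + X(q−y)/q − yD/q ≥ y` because
`(1−y)X ≥ y(D + 1 − q)` and `D ≤ q − y`; and `θ > y` gives `P{>j} ≥ θ` directly.
SUPERSEDED (same seat, same day): `…QuantDominantClosure` proves the far row at EVERY dominant layer `2j < q(T₁+T₂)` from the two-layer giant
bounds alone (extreme profiles); this file is the piece-wise route and is kept as stated.
HONEST STATUS: partial (far-dominant layers); `SingleGateConvClosed`, `GateMove`, CW, `ConvClosedT`, `SDECConvClosed`, `TreeDEC`, `FarTreeRow` remain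
OPEN; the RATE class log\* and the honest sentence of `run/shared/lean/prim/quant/README.md` are unchanged.

* **`LawDec.gateConv_tail_ge_farDominant`**, `LawDec.gateConv_decAt_farDominant_right`, **`LawDec.gateConv_decAt_farDominant`**.

[this work]; single-gate binder: prim-quant-lead g28 (this lane).  Nothing here is cited as a published result.  The gluing rows served
[cite: KozmaNitzan2024, Conjecture 3 (p. 15)]; product measure [cite: Grimmett1999, §1.3 p. 10].
-/

noncomputable section

namespace Summit.CriticalPhenomena.PercolationContinuityZ3.Theorems

namespace Quant

open Finset

/-- the two-point law `{lo, hi; g}` (as in `…QuantLawDEC`) -/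
local notation3 "TP[" lo ", " hi ", " g ", " h "]" =>
  (g : ℝ) * (if (h : ℕ) = (hi : ℕ) then (1 : ℝ) else 0) + (1 - (g : ℝ)) * (if (h : ℕ) = (lo : ℕ) then (1 : ℝ) else 0)

namespace LawDec

/-- **`SingleGateConvClosed` AT A FAR-DOMINANT LAYER, NO HEAVINESS**: `νᵢ = gate_q μᵢ` top-affordable and DEC(j′) at every `j′ < Mᵢ` (any data),
`0 < y < 1`, `y ≤ q ≤ 1`, `4j < q(2T₂ + T₁)` ⟹ `y ≤ Σ_{j < h ≤ M₁+M₂} gate (lconv μ₁ μ₂) q h`. [this work] -/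
theorem gateConv_tail_ge_farDominant (y q T₁ T₂ : ℝ) (j M₁ M₂ : ℕ) (μ₁ μ₂ : ℕ → ℝ)
    (hy0 : 0 < y) (hy1 : y < 1) (hyq : y ≤ q) (hq1 : q ≤ 1)
    (h10 : ∀ h, 0 ≤ μ₁ h) (h1M : ∀ h, M₁ < h → μ₁ h = 0) (h11 : ∑ h ∈ Finset.range (M₁ + 1), μ₁ h = 1)
    (hT₁ : ∑ h ∈ Finset.range (M₁ + 1), (h : ℝ) * μ₁ h = T₁) (hta1 : y * (M₁ : ℝ) ≤ q * T₁)
    (hdec1 : ∀ j', j' < M₁ → DECAt y j' M₁ (gate μ₁ q))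
    (h20 : ∀ h, 0 ≤ μ₂ h) (h2M : ∀ h, M₂ < h → μ₂ h = 0) (h21 : ∑ h ∈ Finset.range (M₂ + 1), μ₂ h = 1)
    (hT₂ : ∑ h ∈ Finset.range (M₂ + 1), (h : ℝ) * μ₂ h = T₂) (hta2 : y * (M₂ : ℝ) ≤ q * T₂)
    (hdec2 : ∀ j', j' < M₂ → DECAt y j' M₂ (gate μ₂ q)) (hdom : 4 * (j : ℝ) < q * (2 * T₂ + T₁)) :
    y ≤ ∑ h ∈ Finset.Ico (j + 1) (M₁ + M₂ + 1), gate (lconv M₁ M₂ μ₁ μ₂) q h := by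
  classical
  have hq0 : 0 < q := hy0.trans_le hyq
  -- the gated laws
  obtain ⟨hν10, hν1M, hν11⟩ := gate_laws M₁ μ₁ q hq0.le hq1 h10 h1M h11
  have hν1T : ∑ h ∈ Finset.range (M₁ + 1), (h : ℝ) * gate μ₁ q h = q * T₁ := by rw [sum_mul_gate, hT₁]
  obtain ⟨hν20, hν2M, hν21⟩ := gate_laws M₂ μ₂ q hq0.le hq1 h20 h2M h21
  have hν2T : ∑ h ∈ Finset.range (M₂ + 1), (h : ℝ) * gate μ₂ q h = q * T₂ := by rw [sum_mul_gate, hT₂]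
  have hT1pos : 0 ≤ T₁ := by rw [← hT₁]; exact Finset.sum_nonneg fun h _ => mul_nonneg (Nat.cast_nonneg h) (h10 h)
  have hdom2 : 2 * (j : ℝ) < q * (T₁ + T₂) := by nlinarith
  -- a datum of `ν₂` at layer `j` (Theorem A above the top)
  have hdecj : DECAt y j M₂ (gate μ₂ q) := by
    by_cases hjM : j < M₂
    · exact hdec2 j hjM
    · refine decAt_of_top_le M₂ (gate μ₂ q) hν20 hν2M hν21 y hy1 (fun h hh => ?_) j (not_lt.1 hjM)
      have hhM : h ≤ M₂ := by
        by_contra hc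
        exact (lt_irrefl (0 : ℝ)) (lt_of_lt_of_eq hh (hν2M h (not_le.1 hc)))
      rw [hν2T]
      calc y * (h : ℝ) ≤ y * (M₂ : ℝ) := mul_le_mul_of_nonneg_left (by exact_mod_cast hhM) hy0.le
        _ ≤ q * T₂ := hta2
  rw [decAt_iff_decAtT, hν2T] at hdecj
  obtain ⟨ρ, hρ, lam, g, lo, hi, hl0, hl1, hg, hlohi, hhi, hν₂, hval⟩ := hdecj
  -- bare tails `Ψ`, gated tails, `θ = ν₁{> j}` (as in `gateConv_tail_ge_of_hdecAtT`)
  set Ψ : ℕ → ℝ := fun s => ∑ i ∈ Finset.range (M₁ + 1), μ₁ i * (if j + 1 ≤ i + s then (1 : ℝ) else 0) with hΨ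
  set θ : ℝ := ∑ i ∈ Finset.range (M₁ + 1), (if j + 1 ≤ i then gate μ₁ q i else 0) with hθ
  have hΨ0 : ∀ s, 0 ≤ Ψ s := fun s => Finset.sum_nonneg fun i _ => mul_nonneg (h10 i) (by split_ifs <;> norm_num)
  have hΨ1 : ∀ s, j + 1 ≤ s → Ψ s = 1 := by
    intro s hs
    show ∑ i ∈ Finset.range (M₁ + 1), μ₁ i * (if j + 1 ≤ i + s then (1 : ℝ) else 0) = 1
    have e : ∀ i ∈ Finset.range (M₁ + 1), μ₁ i * (if j + 1 ≤ i + s then (1 : ℝ) else 0) = μ₁ i :=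
      fun i _ => by rw [if_pos (by omega), mul_one]
    rw [Finset.sum_congr rfl e, h11]
  -- the gated tails `q·Ψ(s)` for `s ≤ j`
  have hΨgate : ∀ s, s ≤ j → q * Ψ s = ∑ i ∈ Finset.range (M₁ + 1), gate μ₁ q i * (if j + 1 ≤ i + s then (1 : ℝ) else 0) := by
    intro s hs
    show q * ∑ i ∈ Finset.range (M₁ + 1), μ₁ i * (if j + 1 ≤ i + s then (1 : ℝ) else 0)
      = ∑ i ∈ Finset.range (M₁ + 1), gate μ₁ q i * (if j + 1 ≤ i + s then (1 : ℝ) else 0)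
    rw [Finset.mul_sum]
    refine Finset.sum_congr rfl fun i _ => ?_
    by_cases h1 : j + 1 ≤ i + s
    · rw [if_pos h1, gate_apply, if_neg (by omega)]; ring
    · rw [if_neg h1]; ring
  have hΨνtail : ∀ s, s ≤ j → ∑ i ∈ Finset.range (M₁ + 1), gate μ₁ q i * (if j + 1 ≤ i + s then (1 : ℝ) else 0)
      = ∑ i ∈ Finset.range (M₁ + 1), (if (j - s) + 1 ≤ i then gate μ₁ q i else 0) := by
    intro s hs
    refine Finset.sum_congr rfl fun i _ => ?_
    by_cases h1 : j + 1 ≤ i + s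
    · rw [if_pos h1, if_pos (by omega), mul_one]
    · rw [if_neg h1, if_neg (by omega), mul_zero]
  have hθΨ : q * Ψ 0 = θ := by rw [hΨgate 0 (Nat.zero_le j), hΨνtail 0 (Nat.zero_le j), Nat.sub_zero]
  have hθ0 : 0 ≤ θ := Finset.sum_nonneg fun i _ => by split_ifs; exacts [hν10 i, le_rfl]
  have hΨθ : ∀ s, s ≤ j → θ ≤ q * Ψ s := by
    intro s hs
    rw [hΨgate s hs, hΨνtail s hs, hθ]
    exact sum_gt_antitone M₁ j (j - s) (gate μ₁ q) hν10 (Nat.sub_le j s)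
  have hΨrow : ∀ s, s ≤ j → 2 * ((j : ℝ) - s) < q * T₁ → y ≤ q * Ψ s := by
    intro s hs hd
    rw [hΨgate s hs, hΨνtail s hs]
    refine tail_ge_of_decAt_all y (q * T₁) M₁ (j - s) (gate μ₁ q) hy0 hy1 hν10 hν1M hν11 hν1T hta1 hdec1 ?_
    rw [Nat.cast_sub hs]; exact hd
  have hyq' : (1 - q) * y / q = y / q - y := by field_simp
  have hyqy : y ≤ y / q := by rw [le_div_iff₀ hq0]; nlinarith
  have hyq1 : y / q ≤ 1 := by rw [div_le_one hq0]; exact hyq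
  -- the weight split of a component: mass above `j`, deep giant-pair low, the rest; its deep mass; its nonzero deep mass
  set up : ρ → ℝ := fun r => g r * (if j + 1 ≤ hi r then (1 : ℝ) else 0) + (1 - g r) * (if j + 1 ≤ lo r then (1 : ℝ) else 0) with hup
  set deep : ρ → ℝ := fun r => g r * (if hi r ≤ j ∧ (hi r : ℝ) + j < q * T₂ then (1 : ℝ) else 0)
    + (1 - g r) * (if lo r ≤ j ∧ (lo r : ℝ) + j < q * T₂ then (1 : ℝ) else 0) with hdeep
  set deepnz : ρ → ℝ := fun r => g r * (if (hi r ≤ j ∧ (hi r : ℝ) + j < q * T₂) ∧ 1 ≤ hi r then (1 : ℝ) else 0)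
    + (1 - g r) * (if (lo r ≤ j ∧ (lo r : ℝ) + j < q * T₂) ∧ 1 ≤ lo r then (1 : ℝ) else 0) with hdeepnz
  -- PER PIECE: `∃ v a d`, `up + v + a = 1`, `0 ≤ d ≤ a`, `v + d ≤ deep`, `d ≤ deepnz`, and the value bound
  have hcomp : ∀ r, 0 < lam r → ∃ v a d : ℝ, 0 ≤ v ∧ 0 ≤ a ∧ 0 ≤ d ∧ d ≤ a ∧ up r + v + a = 1 ∧ v + d ≤ deep r ∧ d ≤ deepnz r ∧
      y + ((1 - y) * up r - y * v + (1 - q) * y / q * a) + v * θ / q - y / q * d ≤ g r * Ψ (hi r) + (1 - g r) * Ψ (lo r) :=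
    fun r hr => gated_piece_budget y q T₁ T₂ j M₁ M₂ (lo r) (hi r) (g r) μ₁ hy0 hy1 hyq hq1 h10 h1M h11 hT₁ hta1 hdec1 hta2
      (hg r) (hlohi r) (hhi r) (hval r hr) hdom
  -- choose the splits (zero for uncharged components)
  have hcomp' : ∀ r, ∃ v a d : ℝ, 0 ≤ v ∧ 0 ≤ a ∧ 0 ≤ d ∧ d ≤ a ∧ (0 < lam r → up r + v + a = 1) ∧ v + d ≤ deep r ∧
      d ≤ deepnz r ∧ (0 < lam r →
      y + ((1 - y) * up r - y * v + (1 - q) * y / q * a) + v * θ / q - y / q * d ≤ g r * Ψ (hi r) + (1 - g r) * Ψ (lo r)) := by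
    intro r
    by_cases hr : 0 < lam r
    · obtain ⟨v, a, d, h1, h2, h3, h4, h5, h6, h7, h8⟩ := hcomp r hr
      exact ⟨v, a, d, h1, h2, h3, h4, fun _ => h5, h6, h7, fun _ => h8⟩
    · refine ⟨0, 0, 0, le_rfl, le_rfl, le_rfl, le_rfl, fun h => absurd h hr, ?_, ?_, fun h => absurd h hr⟩
      · rw [add_zero]; simp only [hdeep]
        exact add_nonneg (mul_nonneg (hg r).1 (by split_ifs <;> norm_num)) (mul_nonneg (by linarith [(hg r).2]) (by split_ifs <;> norm_num))
      · simp only [hdeepnz]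
        exact add_nonneg (mul_nonneg (hg r).1 (by split_ifs <;> norm_num)) (mul_nonneg (by linarith [(hg r).2]) (by split_ifs <;> norm_num))
  choose v a d hv0 ha0 hd0 hda hsplit hvd hdnz hW using hcomp'
  -- aggregates
  set X : ℝ := ∑ r, lam r * up r with hX
  set V : ℝ := ∑ r, lam r * v r with hV
  set A : ℝ := ∑ r, lam r * a r with hA
  set D : ℝ := ∑ r, lam r * d r with hD
  have hXVA : X + V + A = 1 := by
    rw [hX, hV, hA, ← Finset.sum_add_distrib, ← Finset.sum_add_distrib, ← hl1]
    refine Finset.sum_congr rfl fun r _ => ?_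
    rcases (hl0 r).eq_or_lt with hz | hpos
    · rw [← hz]; ring
    · have := hsplit r hpos
      calc lam r * up r + lam r * v r + lam r * a r = lam r * (up r + v r + a r) := by ring
        _ = lam r := by rw [this, mul_one]
  have hup0 : ∀ r, 0 ≤ up r := fun r => by
    simp only [hup]
    exact add_nonneg (mul_nonneg (hg r).1 (by split_ifs <;> norm_num)) (mul_nonneg (by linarith [(hg r).2]) (by split_ifs <;> norm_num))
  have hX0 : 0 ≤ X := Finset.sum_nonneg fun r _ => mul_nonneg (hl0 r) (hup0 r)
  have hV0 : 0 ≤ V := Finset.sum_nonneg fun r _ => mul_nonneg (hl0 r) (hv0 r)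
  have hD0 : 0 ≤ D := Finset.sum_nonneg fun r _ => mul_nonneg (hl0 r) (hd0 r)
  have hDA : D ≤ A := Finset.sum_le_sum fun r _ => mul_le_mul_of_nonneg_left (hda r) (hl0 r)
  -- `X = ν₂{> j}`, `V + D ≤ ν₂{deep}`, `D ≤ ν₂{deep, ≥ 1}`
  have eX : X = ∑ h ∈ Finset.range (M₂ + 1), (if j + 1 ≤ h then gate μ₂ q h else 0) := by
    have := sum_datum M₂ (gate μ₂ q) lam g lo hi (fun h => if j + 1 ≤ h then (1 : ℝ) else 0) hlohi hhi hν₂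
    rw [hX]
    calc ∑ r, lam r * up r = ∑ r, lam r * (g r * (if j + 1 ≤ hi r then (1 : ℝ) else 0)
          + (1 - g r) * (if j + 1 ≤ lo r then (1 : ℝ) else 0)) := rfl
      _ = ∑ h ∈ Finset.range (M₂ + 1), (if j + 1 ≤ h then (1 : ℝ) else 0) * gate μ₂ q h := this.symm
      _ = _ := Finset.sum_congr rfl fun h _ => by split_ifs <;> ring
  have eDeep : ∑ r, lam r * deep r
      = ∑ h ∈ Finset.range (M₂ + 1), (if h ≤ j ∧ (h : ℝ) + j < q * T₂ then gate μ₂ q h else 0) := by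
    have := sum_datum M₂ (gate μ₂ q) lam g lo hi (fun h => if h ≤ j ∧ (h : ℝ) + j < q * T₂ then (1 : ℝ) else 0) hlohi hhi hν₂
    calc ∑ r, lam r * deep r = ∑ r, lam r * (g r * (if hi r ≤ j ∧ (hi r : ℝ) + j < q * T₂ then (1 : ℝ) else 0)
          + (1 - g r) * (if lo r ≤ j ∧ (lo r : ℝ) + j < q * T₂ then (1 : ℝ) else 0)) := rfl
      _ = ∑ h ∈ Finset.range (M₂ + 1), (if h ≤ j ∧ (h : ℝ) + j < q * T₂ then (1 : ℝ) else 0) * gate μ₂ q h := this.symm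
      _ = _ := Finset.sum_congr rfl fun h _ => by split_ifs <;> ring
  have eDeepnz : ∑ r, lam r * deepnz r
      = ∑ h ∈ Finset.range (M₂ + 1), (if (h ≤ j ∧ (h : ℝ) + j < q * T₂) ∧ 1 ≤ h then gate μ₂ q h else 0) := by
    have := sum_datum M₂ (gate μ₂ q) lam g lo hi
      (fun h => if (h ≤ j ∧ (h : ℝ) + j < q * T₂) ∧ 1 ≤ h then (1 : ℝ) else 0) hlohi hhi hν₂
    calc ∑ r, lam r * deepnz r = ∑ r, lam r * (g r * (if (hi r ≤ j ∧ (hi r : ℝ) + j < q * T₂) ∧ 1 ≤ hi r then (1 : ℝ) else 0)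
          + (1 - g r) * (if (lo r ≤ j ∧ (lo r : ℝ) + j < q * T₂) ∧ 1 ≤ lo r then (1 : ℝ) else 0)) := rfl
      _ = ∑ h ∈ Finset.range (M₂ + 1), (if (h ≤ j ∧ (h : ℝ) + j < q * T₂) ∧ 1 ≤ h then (1 : ℝ) else 0) * gate μ₂ q h :=
          this.symm
      _ = _ := Finset.sum_congr rfl fun h _ => by split_ifs <;> ring
  have hVD : V + D ≤ ∑ h ∈ Finset.range (M₂ + 1), (if h ≤ j ∧ (h : ℝ) + j < q * T₂ then gate μ₂ q h else 0) := by
    rw [← eDeep, hV, hD, ← Finset.sum_add_distrib]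
    refine Finset.sum_le_sum fun r _ => ?_
    have := mul_le_mul_of_nonneg_left (hvd r) (hl0 r)
    linarith [mul_add (lam r) (v r) (d r)]
  have hDnz : D ≤ ∑ h ∈ Finset.range (M₂ + 1), (if (h ≤ j ∧ (h : ℝ) + j < q * T₂) ∧ 1 ≤ h then gate μ₂ q h else 0) := by
    rw [← eDeepnz, hD]
    exact Finset.sum_le_sum fun r _ => mul_le_mul_of_nonneg_left (hdnz r) (hl0 r)
  -- deepLows for `ν₂` at the layer `j`
  have hgb2 := deepLows_le_giants_pred y (q * T₂) M₂ j (gate μ₂ q) hy0 hy1 hν20 hν2M hν21 hν2T hta2 hdec2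
  rw [← eX] at hgb2
  -- if there is any nonzero debt, the zero atom is deep and the debt is at most `q − y`
  have hDqy : y * D ≤ (q - y) * X ∧ D ≤ q - y := by
    rcases hD0.eq_or_lt with hz | hpos
    · rw [← hz, mul_zero]; exact ⟨mul_nonneg (by linarith) hX0, by linarith⟩
    · -- a charged nonzero deep atom exists ⇒ `j < qT₂`
      have hj : (0 : ℝ) + j < q * T₂ := by
        by_contra hc
        have : ∑ h ∈ Finset.range (M₂ + 1), (if (h ≤ j ∧ (h : ℝ) + j < q * T₂) ∧ 1 ≤ h then gate μ₂ q h else 0) = 0 := by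
          refine Finset.sum_eq_zero fun h _ => ?_
          rw [if_neg]
          rintro ⟨⟨_, hh⟩, _⟩
          exact hc (by have : (0 : ℝ) ≤ h := Nat.cast_nonneg h; linarith)
        rw [this] at hDnz; linarith
      -- the largest deep atom `i₀ ≤ j` is a dominant layer for `ν₂`: all deep atoms and the zero lie at or below it
      let i₀ : ℕ := Nat.findGreatest (fun l => (l : ℝ) + j < q * T₂) j
      have hi₀P : ((i₀ : ℕ) : ℝ) + j < q * T₂ :=
        Nat.findGreatest_spec (P := fun l => (l : ℝ) + j < q * T₂) (Nat.zero_le j) (by simpa using hj)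
      have hi₀j : i₀ ≤ j := Nat.findGreatest_le j
      have hi₀dom : 2 * ((i₀ : ℕ) : ℝ) < q * T₂ := by
        have : ((i₀ : ℕ) : ℝ) ≤ j := by exact_mod_cast hi₀j
        linarith
      have hrow2 := tail_ge_of_decAt_all y (q * T₂) M₂ i₀ (gate μ₂ q) hy0 hy1 hν20 hν2M hν21 hν2T hta2 hdec2 hi₀dom
      have hsplit2 := sum_le_add_sum_gt M₂ i₀ (gate μ₂ q)
      rw [hν21] at hsplit2
      -- `ν₂{≤ i₀} ≤ 1 − y` and it contains the zero atom and every nonzero deep atom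
      have hle : ∑ h ∈ Finset.range (M₂ + 1), (if (h ≤ j ∧ (h : ℝ) + j < q * T₂) ∧ 1 ≤ h then gate μ₂ q h else 0)
          + gate μ₂ q 0 ≤ ∑ h ∈ Finset.range (M₂ + 1), (if h ≤ i₀ then gate μ₂ q h else 0) := by
        have e0 : gate μ₂ q 0 = ∑ h ∈ Finset.range (M₂ + 1), (if h = 0 then gate μ₂ q h else 0) := by
          rw [Finset.sum_ite_eq' (Finset.range (M₂ + 1)) 0, if_pos (Finset.mem_range.2 (Nat.succ_pos M₂))]
        rw [e0, ← Finset.sum_add_distrib]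
        refine Finset.sum_le_sum fun h _ => ?_
        have hνh := hν20 h
        by_cases hA : (h ≤ j ∧ (h : ℝ) + j < q * T₂) ∧ 1 ≤ h
        · rw [if_pos hA, if_neg (by omega), if_pos (Nat.le_findGreatest hA.1.1 hA.1.2), add_zero]
        · rw [if_neg hA]
          by_cases h0 : h = 0
          · subst h0; rw [if_pos rfl, if_pos (Nat.zero_le _), zero_add]
          · rw [if_neg h0, add_zero]; split_ifs; exacts [hνh, le_rfl]
      have hzero : 1 - q ≤ gate μ₂ q 0 := by
        rw [gate_apply, if_pos rfl]
        have := mul_nonneg hq0.le (h20 0)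
        linarith only [this]
      have hDle : D ≤ q - y := by linarith only [hDnz, hle, hsplit2, hrow2, hzero]
      refine ⟨?_, hDle⟩
      -- `(1−y)X ≥ y·ν₂{deep} ≥ y(D + ν₂ 0) ≥ y(D + 1 − q)` and `D ≤ q − y`
      have hdeepge : D + gate μ₂ q 0 ≤ ∑ h ∈ Finset.range (M₂ + 1), (if h ≤ j ∧ (h : ℝ) + j < q * T₂ then gate μ₂ q h else 0) := by
        have e0 : gate μ₂ q 0 = ∑ h ∈ Finset.range (M₂ + 1), (if h = 0 then gate μ₂ q h else 0) := by
          rw [Finset.sum_ite_eq' (Finset.range (M₂ + 1)) 0, if_pos (Finset.mem_range.2 (Nat.succ_pos M₂))]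
        have : ∑ h ∈ Finset.range (M₂ + 1), (if (h ≤ j ∧ (h : ℝ) + j < q * T₂) ∧ 1 ≤ h then gate μ₂ q h else 0)
            + gate μ₂ q 0 ≤ ∑ h ∈ Finset.range (M₂ + 1), (if h ≤ j ∧ (h : ℝ) + j < q * T₂ then gate μ₂ q h else 0) := by
          rw [e0, ← Finset.sum_add_distrib]
          refine Finset.sum_le_sum fun h _ => ?_
          by_cases hA : (h ≤ j ∧ (h : ℝ) + j < q * T₂) ∧ 1 ≤ h
          · rw [if_pos hA, if_neg (by omega), if_pos hA.1, add_zero]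
          · rw [if_neg hA]
            by_cases h0 : h = 0
            · subst h0; rw [if_pos rfl, if_pos ⟨Nat.zero_le _, by simpa using hj⟩, zero_add]
            · rw [if_neg h0, add_zero]; split_ifs; exacts [hν20 h, le_rfl]
        linarith only [this, hDnz]
      have h1a : y * (D + gate μ₂ q 0) ≤ (1 - y) * X := le_trans (mul_le_mul_of_nonneg_left hdeepge hy0.le) hgb2
      have h1 : y * (D + (1 - q)) ≤ (1 - y) * X := by
        have := mul_le_mul_of_nonneg_left (add_le_add_left hzero D) hy0.le
        linarith only [this, h1a]
      -- `(D + 1 − q)(q − y) ≥ D(1 − y)` since `D ≤ q − y`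
      have h2 : D * (1 - y) ≤ (D + (1 - q)) * (q - y) := by
        have h2' : 0 ≤ (1 - q) * (q - y - D) := mul_nonneg (by linarith only [hq1]) (by linarith only [hDle])
        have e : (D + (1 - q)) * (q - y) - D * (1 - y) = (1 - q) * (q - y - D) := by ring
        linarith only [e, h2']
      have h3 : y * (D * (1 - y)) ≤ y * ((D + (1 - q)) * (q - y)) := mul_le_mul_of_nonneg_left h2 hy0.le
      have h4 : (y * (D + (1 - q))) * (q - y) ≤ ((1 - y) * X) * (q - y) := mul_le_mul_of_nonneg_right h1 (by linarith only [hyq])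
      have h5 : (1 - y) * (y * D) ≤ (1 - y) * ((q - y) * X) := by
        have e1 : (1 - y) * (y * D) = y * (D * (1 - y)) := by ring
        have e2 : (1 - y) * ((q - y) * X) = ((1 - y) * X) * (q - y) := by ring
        have e3 : y * ((D + (1 - q)) * (q - y)) = (y * (D + (1 - q))) * (q - y) := by ring
        rw [e1, e2]; linarith only [h3, h4, e3]
      exact le_of_mul_le_mul_left h5 (by linarith only [hy1])
  -- sum of the per-piece bounds
  set S : ℝ := ∑ r, lam r * (g r * Ψ (hi r) + (1 - g r) * Ψ (lo r)) with hS
  have hsum : y + ((1 - y) * X - y * V + (1 - q) * y / q * A) + V * θ / q - y / q * D ≤ S := by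
    have e1 : ∑ r, lam r * (y + ((1 - y) * up r - y * v r + (1 - q) * y / q * a r) + v r * θ / q - y / q * d r)
        = y * (∑ r, lam r) + ((1 - y) * X - y * V + (1 - q) * y / q * A) + V * θ / q - y / q * D := by
      rw [hX, hV, hA, hD]
      simp only [Finset.mul_sum, Finset.sum_mul, Finset.sum_div, ← Finset.sum_add_distrib, ← Finset.sum_sub_distrib]
      exact Finset.sum_congr rfl fun r _ => by ring
    rw [hl1, mul_one] at e1
    rw [← e1, hS]
    refine Finset.sum_le_sum fun r _ => ?_
    rcases (hl0 r).eq_or_lt with hz | hpos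
    · rw [← hz, zero_mul, zero_mul]
    · exact mul_le_mul_of_nonneg_left (hW r hpos) (hl0 r)
  -- the tail identity and the direct bound
  have esum : ∑ i ∈ Finset.range (M₁ + 1), μ₁ i * (if j + 1 ≤ i then (1 : ℝ) else 0) = θ / q := by
    have e0 : Ψ 0 = ∑ i ∈ Finset.range (M₁ + 1), μ₁ i * (if j + 1 ≤ i then (1 : ℝ) else 0) := by
      show ∑ i ∈ Finset.range (M₁ + 1), μ₁ i * (if j + 1 ≤ i + 0 then (1 : ℝ) else 0) = _
      simp only [Nat.add_zero]
    rw [← e0, ← hθΨ]; field_simp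
  have htail := gateConv_tail_eq_pieces M₁ M₂ j μ₁ μ₂ q lam g lo hi hlohi hhi hν₂
  rw [esum] at htail
  have hdirect : θ ≤ ∑ h ∈ Finset.Ico (j + 1) (M₁ + M₂ + 1), gate (lconv M₁ M₂ μ₁ μ₂) q h := by
    have h := gateConv_tail_ge_theta M₁ M₂ j μ₁ μ₂ q hq0.le h10 h20 h21
    rw [esum, show q * (θ / q) = θ by field_simp] at h
    exact h
  rw [htail]
  show y ≤ S - (1 - q) * (θ / q)
  have hAeq : A = 1 - X - V := by linarith only [hXVA]
  by_cases hθy : y ≤ θ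
  · rw [htail] at hdirect; exact hθy.trans hdirect
  · have hθy' : θ ≤ y := le_of_lt (not_le.1 hθy)
    have e1 : V * θ / q - (1 - q) * (θ / q) = (V - (1 - q)) * (θ / q) := by ring
    by_cases hVq : 1 - q ≤ V
    · -- `U ≥ (y/q)·D`
      have h1 : (1 - q) * y / q * D ≤ (1 - q) * y / q * A :=
        mul_le_mul_of_nonneg_left hDA (by rw [hyq']; linarith only [hyqy])
      have h2 : y * (V + D) ≤ (1 - y) * X := le_trans (mul_le_mul_of_nonneg_left hVD hy0.le) hgb2
      have e : y / q * D = y * D + (1 - q) * y / q * D := by field_simp; ring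
      have hU : y / q * D ≤ (1 - y) * X - y * V + (1 - q) * y / q * A := by
        rw [e]; linarith only [h1, h2]
      have h3 : 0 ≤ (V - (1 - q)) * (θ / q) := mul_nonneg (by linarith only [hVq]) (div_nonneg hθ0 hq0.le)
      linarith only [hsum, hU, h3, e1]
    · -- `V < 1 − q`: evaluate the affine bound at `θ = y`
      have hslope : (V - (1 - q)) * (y / q) ≤ (V - (1 - q)) * (θ / q) :=
        mul_le_mul_of_nonpos_left (div_le_div_of_nonneg_right hθy' hq0.le) (by linarith only [hVq])
      have e2 : ((1 - y) * X - y * V + (1 - q) * y / q * A) + (V - (1 - q)) * (y / q) = X * (q - y) / q := by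
        rw [hAeq]; field_simp; ring
      have h4 : y / q * D ≤ X * (q - y) / q := by
        rw [div_mul_eq_mul_div]
        exact div_le_div_of_nonneg_right (by linarith only [hDqy.1]) hq0.le
      linarith only [hsum, hslope, e1, e2, h4]

/-- **DEC AT A FAR-DOMINANT LAYER OF THE GATED CONVOLUTION, NO HEAVINESS** (`decAt_of_tail_ge` + `gateConv_tail_ge_farDominant`). [this work] -/
theorem gateConv_decAt_farDominant_right (y q T₁ T₂ : ℝ) (j M₁ M₂ : ℕ) (μ₁ μ₂ : ℕ → ℝ)
    (hy0 : 0 < y) (hy1 : y < 1) (hyq : y ≤ q) (hq1 : q ≤ 1)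
    (h10 : ∀ h, 0 ≤ μ₁ h) (h1M : ∀ h, M₁ < h → μ₁ h = 0) (h11 : ∑ h ∈ Finset.range (M₁ + 1), μ₁ h = 1)
    (hT₁ : ∑ h ∈ Finset.range (M₁ + 1), (h : ℝ) * μ₁ h = T₁) (hta1 : y * (M₁ : ℝ) ≤ q * T₁)
    (hdec1 : ∀ j', j' < M₁ → DECAt y j' M₁ (gate μ₁ q))
    (h20 : ∀ h, 0 ≤ μ₂ h) (h2M : ∀ h, M₂ < h → μ₂ h = 0) (h21 : ∑ h ∈ Finset.range (M₂ + 1), μ₂ h = 1)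
    (hT₂ : ∑ h ∈ Finset.range (M₂ + 1), (h : ℝ) * μ₂ h = T₂) (hta2 : y * (M₂ : ℝ) ≤ q * T₂)
    (hdec2 : ∀ j', j' < M₂ → DECAt y j' M₂ (gate μ₂ q)) (hdom : 4 * (j : ℝ) < q * (2 * T₂ + T₁)) :
    DECAt y j (M₁ + M₂) (gate (lconv M₁ M₂ μ₁ μ₂) q) := by
  have hq0 : 0 < q := hy0.trans_le hyq
  obtain ⟨hP0, hPM, hP1⟩ := gate_laws (M₁ + M₂) (lconv M₁ M₂ μ₁ μ₂) q hq0.le hq1 (lconv_nonneg M₁ M₂ μ₁ μ₂ h10 h20)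
    (fun h hh => lconv_eq_zero M₁ M₂ μ₁ μ₂ h hh) (sum_lconv M₁ M₂ μ₁ μ₂ h11 h21)
  exact decAt_of_tail_ge (M₁ + M₂) _ hP0 hPM hP1 y j hy0
    (gateConv_tail_ge_farDominant y q T₁ T₂ j M₁ M₂ μ₁ μ₂ hy0 hy1 hyq hq1 h10 h1M h11 hT₁ hta1 hdec1 h20 h2M h21 hT₂ hta2 hdec2 hdom)

/-- **`SingleGateConvClosed` HOLDS AT EVERY FAR-DOMINANT LAYER** (`4j < q(2T₂ + T₁)` or `4j < q(2T₁ + T₂)`), for ARBITRARY DEC data of both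
gated factors. [this work] -/
theorem gateConv_decAt_farDominant (y q T₁ T₂ : ℝ) (j M₁ M₂ : ℕ) (μ₁ μ₂ : ℕ → ℝ)
    (hy0 : 0 < y) (hy1 : y < 1) (hyq : y ≤ q) (hq1 : q ≤ 1)
    (h10 : ∀ h, 0 ≤ μ₁ h) (h1M : ∀ h, M₁ < h → μ₁ h = 0) (h11 : ∑ h ∈ Finset.range (M₁ + 1), μ₁ h = 1)
    (hT₁ : ∑ h ∈ Finset.range (M₁ + 1), (h : ℝ) * μ₁ h = T₁) (hta1 : y * (M₁ : ℝ) ≤ q * T₁)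
    (hdec1 : ∀ j', j' < M₁ → DECAt y j' M₁ (gate μ₁ q))
    (h20 : ∀ h, 0 ≤ μ₂ h) (h2M : ∀ h, M₂ < h → μ₂ h = 0) (h21 : ∑ h ∈ Finset.range (M₂ + 1), μ₂ h = 1)
    (hT₂ : ∑ h ∈ Finset.range (M₂ + 1), (h : ℝ) * μ₂ h = T₂) (hta2 : y * (M₂ : ℝ) ≤ q * T₂)
    (hdec2 : ∀ j', j' < M₂ → DECAt y j' M₂ (gate μ₂ q))
    (hdom : 4 * (j : ℝ) < q * (2 * T₂ + T₁) ∨ 4 * (j : ℝ) < q * (2 * T₁ + T₂)) :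
    DECAt y j (M₁ + M₂) (gate (lconv M₁ M₂ μ₁ μ₂) q) := by
  rcases hdom with hd | hd
  · exact gateConv_decAt_farDominant_right y q T₁ T₂ j M₁ M₂ μ₁ μ₂ hy0 hy1 hyq hq1 h10 h1M h11 hT₁ hta1 hdec1 h20 h2M h21 hT₂
      hta2 hdec2 hd
  · rw [lconv_comm, Nat.add_comm]
    exact gateConv_decAt_farDominant_right y q T₂ T₁ j M₂ M₁ μ₂ μ₁ hy0 hy1 hyq hq1 h20 h2M h21 hT₂ hta2 hdec2 h10 h1M h11 hT₁
      hta1 hdec1 hd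

end LawDec

end Quant

end Summit.CriticalPhenomena.PercolationContinuityZ3.Theorems
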